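import Summits.BirchSwinnertonDyer.Rank1Residual.Supersingular.KobayashiSqueezeReal
import Summits.BirchSwinnertonDyer.Rank1Residual.Supersingular.RankZeroUpperBoundProp48
import Literature.NumberTheory.EllipticCurves.PlusMinusPAdicLFunctionProofs
import HarnessLib

/-!
# Print cell `bsd-print-x6` (leaf `ClassX6 ∧ r_an = 0`, CornersAll §1b row A6), prover p2:
# the rank-zero UPPER half `ord_p #Ш ≤ ord_p #Ш_an` DERIVED IN THE KERNEL from Kato's divisibility
# through Kobayashi's ± Coleman maps (Kobayashi 2003 Thm. 4.1) and the exact ± control at `n = 0`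
# (B. D. Kim 2013 Cor. 3.15) — and the unit-value sub-leaf closed on that road

HONEST FRAMING (cell `bsd-print-x6`, run/shared/lean/pub/bsd-print-x6/; PRINT tier D-0131 (2)).
THEOREMS ONLY — no definition, no new named fact, nothing about any particular curve is asserted,
BSD is not proved by any of this. Strategy sentence of this seat (verbatim): «Kato divisibility +
Kobayashi ± / Sprung ♯♭ control ⇒ #Ш[p^∞] ≤ the p-adic bound; close every UNIT-VALUE cell
(ord_p(L(E,1)/Ω · ∏c_ℓ · #tor⁻²) = 0) with the trivial lower bound — no main-conjecture equality
needed». This file is the FIRST half of the sentence for `a_p = 0` (every X6 pair at odd `p`: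
`ClassX6.frobeniusTrace_eq_zero`), companion of `PrintX6UnitValue.lean` (the second half on the
printed upper-bound facts Sprung 2024 Cor. 1.2 / Perrin-Riou 2003 Prop. 4.8 / Wuthrich 2014
Prop. 21, each carrying a reading flag because its printed proof is a one-line attribution).

## What is proved (answering the cell referee's audit points K-i / K-ii / K-iii, REFEREE.md §3.4)

`missingUpperBoundAt_of_thm41_of_towerSurj`: for `W/ℚ` globally minimal elliptic, `p ≠ 2` of good
reduction with `a_p = 0`, `E[p]` irreducible, `ρ̄_{E,p^m}` onto for every `m` (K-i: the INTEGRAL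
clause of Kobayashi's Thm. 4.1 needs `p`-adic surjectivity, printed "If … `Gal(ℚ̄/ℚ) → GL_{ℤ_p}(T)`
is surjective, then we can take `n = 0`"), and `L(E,1) ≠ 0`: `Typed.MissingUpperBoundAt W p`
(`ord_p #Ш(E/ℚ) ≤ ord_p #Ш(E/ℚ)_an`, `#Ш_an` rational), granted BY NAME the refereed facts
* Kobayashi, Invent. Math. 152 (2003) Thm. 4.1 (`η = 1`, integral clause) —
  `Kobayashi2003.thm41_signedCharIdeal_divisibility` (`h41`): `L_p^ε ∈ char X^ε(E/ℚ_∞)` — THIS IS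
  Kato's divisibility (Astérisque 295 Thm. 12.5 (4)) pushed through the ± Coleman map (§7 of the
  source);
* Kobayashi 2003 Thm. 1.2 — `Kobayashi2003.thm12_signedSelmerDual_finite_torsion` (`h12`);
* B. D. Kim, J. Aust. Math. Soc. 95 (2013) Cor. 3.15 — `BDKim2013.cor315_signedCharValue_rankZero`
  (`hKim`): `ξ^ε(0) ∼ #Sel_{p^∞}(E/ℚ)·∏_ℓ c_ℓ` when `Sel_{p^∞}(E/ℚ)` is finite — the EXACT `n = 0`
  control the referee asks for in K-ii (Kobayashi's Thm. 9.3 is bounded-kernel only; Kim's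
  corollary is the quantitative statement, no `p ∤ Tam` / no anomalous factor at a supersingular
  `p`: `E(ℚ_p)[p] = 0`);
* the period-unit facts `realPeriodRat_eq_unit_mul_plusPeriod(_three)` (`h5`, `h3`; Greenberg–
  Vatsal 2000 §3 Rem. 3.4 + Abbes–Ullmo / Mazur + Edixhoven): `ord_p(Ω⁺_f/Ω_E) = 0` at an odd good
  irreducible prime — needed because the tree's Thm. 4.1 is typed on the `Ω⁺_f`-normalised Pollack
  function (module docstring of `SignedKatoDivisibility.lean`, "Periods");
* modularity `nonempty_modularParametrizationData` (`hmod`: the newform `f` of `E` and the period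
  ratio `ϖ`, `ϖ·Ω_E = Ω⁺_f`), GZK `rank_eq_analyticRank_of_analyticRank_le_one` (`hGZK`: rank `0`,
  `Ш` finite, so `#Sel_{p^∞}(E/ℚ) = #Ш[p^∞]`);
and the tree THEOREMS: Pollack's `L_p^±` exist (`pollack_exists_plusMinusPAdicLFunction_holds`) with
interpolation (3.6) `L^ε(0) = c_ε·[0]⁺_f`, `c_+ = 2`, `c_− = p − 1` PROVED
(`IsPollackPair.constantCoeff_kobayashiL`; K-iii: the units `2`, `p − 1` are displayed, not dropped),
`char X^ε` principal (`charIdeal_isPrincipal_holds`), the cyclotomic setting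
(`exists_isCyclotomic_isTopGenerator_isCyclotomicVariable_holds`), the signed dual datum
(`nonempty_signedSelmerDualData`).

Chain (valuations of constant terms in `ℚ_p`): `char X^ε = (ξ)`, Thm. 4.1 ⇒ `ξ ∣ L^ε`, so
`ord_p ξ(0) ≤ ord_p L^ε(0)`; Kim + GZK ⇒ `ord_p ξ(0) = ord_p ∏c_ℓ + ord_p #Ш`
(`valuation_constantCoeff_xi` on the datum `⟨ξ, 0, 0⟩`); (3.6) ⇒ `ord_p L^ε(0) = ord_p [0]⁺_f =
ord_p(L(E,1)/Ω_E) − ord_p ϖ = ord_p(L(E,1)/Ω_E)`; `p ∤ #E(ℚ)_tors` (irreducible); hence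
`ord_p #Ш ≤ ord_p((L(E,1)/Ω_E)·#tors²/∏c_ℓ) = ord_p #Ш_an`. The sign `ε` is free (we use `ε = 1`,
Kobayashi's `+`).

§2 reads it on the leaf: `X6.missingUpperBoundAt_rankZero_of_thm41` (tower surjectivity is the tree
theorem `ClassX6.imageContainsSL2` + `Kato2004.forall_hasSurjectiveModNGaloisRep_of_imageContainsSL2`:
Serre Props. 12, 21 i), IV-23 at `p ≥ 5`, Wuthrich 2014 Lemma 20 at `p = 3`; `a_p = 0` and (irr)
automatic), `X6.bsdp_of_missingLowerBoundAt_of_thm41` (the X6 ∩ {r = 0} residue is the LOWER bound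
alone on this road too), and the UNIT-VALUE sub-leaf `X6.bsdp_rankZero_of_shaAn_le_of_thm41` /
`X6.padicValNat_shaOrder_eq_zero_of_shaAn_le_of_thm41` (`ord_p #Ш_an ≤ 0 ⇒ BSD(E,p)`, `p ∤ #Ш`).

Beyond-print theorem: NO new mathematics — it is Perrin-Riou 2003 Prop. 4.8 / Kurihara 2002 §0 /
BSTW Rem. 2.3 (i) ("the rank zero BSD formula also follows by descent of Kobayashi's main
Conjecture") for `a_p = 0`, but DERIVED in the kernel from refereed theorems each printed WITH
proof, instead of cited from a statement printed without one. Not covered here: `a_3 = ±3` (class X8,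
Sprung's ♯/♭: cell bsd-print-x8) and `p = 2`.

References: [Kobayashi2003] Thm. 1.2 (p. 2), Thm. 4.1 (p. 8), (3.6) (p. 7); [BDKim2013] Cor. 3.15
(p. 199); [Pollack2003] Thm. 5.6, Prop. 6.18; [Kato2004Asterisque] Thm. 12.5 (4); [GreenbergVatsal2000]
§3 Rem. 3.4; [Serre1972] Props. 12, 21 i); [Wuthrich2014] Lemma 20; [Miller2011LMS] Def. 1.1.
-/

set_option autoImplicit false
-- the landed namespace `Summit.BirchSwinnertonDyer.BirchSwinnertonDyer.Theorems` (summit = problem) trips the linter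
set_option linter.dupNamespace false

noncomputable section

open scoped Classical MatrixGroups ModularForm

open CongruenceSubgroup WeierstrassCurve Literature.NumberTheory.EllipticCurves
  Literature.NumberTheory.EllipticCurves.ModularForms
  Literature.NumberTheory.EllipticCurves.Rank1Residual
  Literature.NumberTheory.EllipticCurves.Rank1Residual.Typed
  Literature.NumberTheory.EllipticCurves.Kobayashi2003 ZpExtension
  Summit.BirchSwinnertonDyer.Rank1Residual.Supersingular

namespace Summit.BirchSwinnertonDyer.BirchSwinnertonDyer.Theorems

variable (W : WeierstrassCurve ℚ) [W.IsElliptic] [W.IsGloballyMinimal] (p : ℕ) [Fact p.Prime]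

/-! ### §1 The ± upper chain on the real objects -/

/-- **Kato's divisibility through Kobayashi's ± Coleman map, plus Kim's exact ± control, bound `Ш`
from ABOVE in rank `0` — in the kernel.** Let `p ≠ 2` be a prime of good reduction of `E = W`
(globally minimal) with `a_p = 0`, `E[p]` irreducible, `ρ̄_{E,p^m}` surjective for every `m`, and
`L(E,1) ≠ 0`. Granted BY NAME Kobayashi 2003 Thm. 4.1 (`h41`, integral clause) and Thm. 1.2
(`h12`), B. D. Kim 2013 Cor. 3.15 (`hKim`), the period-unit facts (`h5`, `h3`), modularity (`hmod`)
and GZK (`hGZK`): `ord_p #Ш(E/ℚ) ≤ ord_p #Ш(E/ℚ)_an` (`MissingUpperBoundAt W p`). Pollack's `L_p^ε`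
and its interpolation (3.6) are tree theorems. Chain in the module docstring: `ξ ∣ L_p^ε`
(Thm. 4.1), `ord_p ξ(0) = ord_p(∏c_ℓ·#Ш)` (Kim + GZK), `ord_p L_p^ε(0) = ord_p(L(E,1)/Ω_E)` ((3.6),
`p ∤ c_ε`, `ord_p ϖ = 0`), `p ∤ #E(ℚ)_tors`.
[cite: Kobayashi2003, Thm. 4.1 (p. 8), Thm. 1.2 (p. 2) and (3.6) (p. 7)] [cite: BDKim2013, Cor. 3.15 (p. 199)]
[cite: GreenbergVatsal2000, §3, Remark 3.4] [cite: Pollack2003, Prop. 6.18] [cite: Miller2011LMS, Def. 1.1] -/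
theorem missingUpperBoundAt_of_thm41_of_towerSurj
    (h41 : Kobayashi2003.thm41_signedCharIdeal_divisibility)
    (h12 : Kobayashi2003.thm12_signedSelmerDual_finite_torsion)
    (hKim : BDKim2013.cor315_signedCharValue_rankZero)
    (h5 : realPeriodRat_eq_unit_mul_plusPeriod) (h3 : realPeriodRat_eq_unit_mul_plusPeriod_three)
    (hmod : nonempty_modularParametrizationData)
    (hGZK : rank_eq_analyticRank_of_analyticRank_le_one)
    (hp : p ≠ 2) (hgood : W.HasGoodReductionAtPrime p) (hap : W.frobeniusTrace p = 0)
    (hirr : W.HasIrreducibleModPGaloisRep p)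
    (htower : ∀ m : ℕ, W.HasSurjectiveModNGaloisRep (p ^ m : ℕ))
    (hL : W.entireLFunction 1 ≠ 0) : MissingUpperBoundAt W p := by
  have hpP : p.Prime := Fact.out
  have hr : W.analyticRank = 0 := analyticRank_eq_zero_of_entireLFunction_one_ne_zero W hL
  -- modularity: the newform `f` of `E` at level `N_E` and the period ratio `ϖ`, `ϖ·Ω_E = Ω⁺_f`
  haveI : NeZero (W.conductorNorm ℤ) := ⟨(W.conductorNorm_pos_holds).ne'⟩
  obtain ⟨Dm⟩ := hmod W
  set f := Dm.f with hf_def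
  have hf : IsNewformOf W f := Dm.isNewformOf
  obtain ⟨ϖ, hϖpos, hϖeq, hΩpos⟩ := Dm.exists_rat_mul_realPeriodRat_eq_plusPeriod
  -- `s = [0]⁺_f`, `t = ϖ · s = L(E,1)/Ω_E`
  set s : ℚ := ratPlusSymbol f 0 with hs_def
  set t : ℚ := ϖ * s with ht_def
  have hLval : W.entireLFunction 1 = (((s : ℝ) * plusPeriod f : ℝ) : ℂ) := hf.entireLFunction_one_eq
  have ht : W.entireLFunction 1 / (W.realPeriodRat : ℂ) = ((t : ℚ) : ℂ) := by
    rw [hLval, ← hϖeq, div_eq_iff (Complex.ofReal_ne_zero.mpr hΩpos.ne'), ht_def]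
    push_cast
    ring
  have hs0 : s ≠ 0 := by
    intro h0
    apply hL
    rw [hLval, h0]
    simp
  have hϖ0 : ϖ ≠ 0 := hϖpos.ne'
  have ht0 : t ≠ 0 := mul_ne_zero hϖ0 hs0
  -- the period ratio is a `p`-adic unit (Greenberg–Vatsal Rem. 3.4 et al., by name)
  have hvϖ : padicValRat p ϖ = 0 := padicValRat_periodRatio_eq_zero h5 h3 W p hp hgood hirr f hf ϖ hϖeq
  have hvs : padicValRat p s = padicValRat p t := by
    rw [ht_def, padicValRat.mul hϖ0 hs0, hvϖ, zero_add]
  -- the cyclotomic setting, a Pollack pair, the signed dual datum for the sign `ε = 1`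
  obtain ⟨κ, hκ, γ, hγ, hγ'⟩ := exists_isCyclotomic_isTopGenerator_isCyclotomicVariable_holds p
  obtain ⟨Lplus, Lminus, hPP⟩ :=
    exists_isPollackPair pollack_exists_plusMinusPAdicLFunction_holds hp hf hgood hap
  set ε : ℤˣ := 1 with hε_def
  obtain ⟨D⟩ := nonempty_signedSelmerDualData W κ ε hγ
  have h12D := h12 W p hp hgood hap κ γ hκ hγ ε D
  haveI : Module.Finite (IwasawaAlgebra p) D.X := h12D.1
  -- `char X^ε = (ξ)` is principal
  obtain ⟨ξ, hξ⟩ := (charIdeal_isPrincipal_holds p D.X).principal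
  have hchar : D.charIdeal = Ideal.span {ξ} := hξ
  -- Kobayashi's `L_p^ε` out of the Pollack pair; Thm. 4.1 (integral clause): `L_p^ε ∈ char X^ε`
  set L := kobayashiL ε Lplus Lminus with hL_def
  have hLsig : IsSignedPAdicLFunction f p ε L := hPP.isSignedPAdicLFunction_kobayashiL ε
  have hmem : L ∈ D.charIdeal :=
    Kobayashi2003.thm41_signedCharIdeal_divisibility.integral h41 hp hgood hap hf hκ hγ hγ' hLsig D
      h12D.2 htower
  rw [hchar, Ideal.mem_span_singleton] at hmem
  obtain ⟨h, hh⟩ := hmem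
  -- (K): `ξ(0) ≠ 0` and `ord_p ξ(0) = ord_p ∏c + ord_p #Ш`
  obtain ⟨hξ0ne, hvξ⟩ := valuation_constantCoeff_xi W p hGZK hL ⟨ξ, 0, 0⟩
    (BDKim2013.cor315_signedCharValue_rankZero.eulerCharacteristic hKim hp hgood hap hκ hγ D h12D
      hchar)
  -- (3.6): `L^ε(0) = c_ε · s`, `p ∤ c_ε`
  have hLε := hPP.constantCoeff_kobayashiL hp hf hgood hap ε
  have hcne : kobayashiConst p ε ≠ 0 := fun hz ↦
    not_dvd_kobayashiConst hp ε (by rw [hz]; exact dvd_zero p)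
  have hc0 : (kobayashiConst p ε : ℚ_[p]) ≠ 0 := by exact_mod_cast hcne
  have hsQ0 : ((s : ℚ) : ℚ_[p]) ≠ 0 := by exact_mod_cast hs0
  have hL0ne : ((PowerSeries.constantCoeff L : ℤ_[p]) : ℚ_[p]) ≠ 0 := by
    rw [hLε]; exact mul_ne_zero hc0 hsQ0
  have hvL : (((PowerSeries.constantCoeff L : ℤ_[p]) : ℚ_[p])).valuation = padicValRat p t := by
    rw [hLε, Padic.valuation_mul hc0 hsQ0, Padic.valuation_natCast,
      padicValNat.eq_zero_of_not_dvd (not_dvd_kobayashiConst hp ε), Padic.valuation_ratCast, hvs]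
    simp
  -- `L = ξ · h`: `ord_p ξ(0) ≤ ord_p L(0)`
  have hfac : ((PowerSeries.constantCoeff L : ℤ_[p]) : ℚ_[p]) =
      ((PowerSeries.constantCoeff ξ : ℤ_[p]) : ℚ_[p]) *
        ((PowerSeries.constantCoeff h : ℤ_[p]) : ℚ_[p]) := by
    rw [hh, map_mul]; push_cast; rfl
  have hh0ne : ((PowerSeries.constantCoeff h : ℤ_[p]) : ℚ_[p]) ≠ 0 :=
    fun h0 ↦ hL0ne (by rw [hfac, h0, mul_zero])
  have hle : (((PowerSeries.constantCoeff ξ : ℤ_[p]) : ℚ_[p])).valuation ≤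
      (((PowerSeries.constantCoeff L : ℤ_[p]) : ℚ_[p])).valuation := by
    rw [hfac, Padic.valuation_mul hξ0ne hh0ne]
    have := valuation_coe_padicInt_nonneg _ hh0ne
    linarith
  have hmain : (padicValNat p W.tamagawaProduct : ℤ) + padicValNat p W.shaOrder ≤ padicValRat p t := by
    rw [← hvL, ← hvξ]; exact hle
  -- `#Ш_an = t · #tors² / ∏c`, `p ∤ #tors`
  refine ⟨t * (W.torsionOrder : ℚ) ^ 2 / (W.tamagawaProduct : ℚ),
    shaAn_eq_of_analyticRank_eq_zero W hGZK hr ht, ?_⟩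
  rw [padicValRat_shaAn_witness W p hirr ht0]
  linarith

/-! ### §2 On the leaf `ClassX6 W p ∧ r_an = 0`, `p` odd -/

/-- **X6 ∩ {r_an = 0}, odd `p`: the UPPER half `ord_p #Ш ≤ ord_p #Ш_an` by the Kobayashi–Kato ± road,
in the kernel.** Every local hypothesis of `missingUpperBoundAt_of_thm41_of_towerSurj` is automatic on
the leaf: good reduction (`ClassX6 = GoodSS ∧ …`), `a_p = 0` (`ClassX6.frobeniusTrace_eq_zero`: Hasse
at `p ≥ 5`, the clause `a_3 = 0` at `3`), `E[p]` irreducible (`ClassX6.irr`, Serre Prop. 12), the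
`p`-adic tower onto (`ClassX6.imageContainsSL2` + `Kato2004.forall_hasSurjectiveModNGaloisRep_of_imageContainsSL2`:
Serre Prop. 21 i) / IV-23, Wuthrich Lemma 20 at `p = 3`), `L(E,1) ≠ 0` (modularity `hmod'`,
`r_an = 0`). Binders: `h41`, `h12`, `hKim`, `h5`, `h3`, `hmod`, `hmod'`, `hGZK` — refereed, by name.
[cite: Kobayashi2003, Thm. 4.1 (p. 8) and Thm. 1.2 (p. 2)] [cite: BDKim2013, Cor. 3.15 (p. 199)]
[cite: Serre1972, §1.11 Prop. 12 and §5.4 Prop. 21 i)] [cite: Wuthrich2014, Lemma 20 (p. 399)]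
[cite: GreenbergVatsal2000, §3, Remark 3.4] [cite: Miller2011LMS, Def. 1.1] -/
theorem X6.missingUpperBoundAt_rankZero_of_thm41
    (h41 : Kobayashi2003.thm41_signedCharIdeal_divisibility)
    (h12 : Kobayashi2003.thm12_signedSelmerDual_finite_torsion)
    (hKim : BDKim2013.cor315_signedCharValue_rankZero)
    (h5 : realPeriodRat_eq_unit_mul_plusPeriod) (h3 : realPeriodRat_eq_unit_mul_plusPeriod_three)
    (hmod : nonempty_modularParametrizationData) (hmod' : hasEntireLFunction_rat)
    (hGZK : rank_eq_analyticRank_of_analyticRank_le_one)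
    (hp : p ≠ 2) (hX : ClassX6 W p) (h0 : W.analyticRank = 0) : MissingUpperBoundAt W p :=
  missingUpperBoundAt_of_thm41_of_towerSurj W p h41 h12 hKim h5 h3 hmod hGZK hp hX.1.1
    (ClassX6.frobeniusTrace_eq_zero W p hp hX) (ClassX6.irr W p hp hX)
    (Kato2004.forall_hasSurjectiveModNGaloisRep_of_imageContainsSL2 W p
      (ClassX6.imageContainsSL2 W p hp hX))
    ((W.analyticRank_eq_zero_iff_holds (hmod' W)).1 h0)

/-- **X6 ∩ {r_an = 0}, odd `p`: on the Kobayashi–Kato road too the residue is the LOWER bound alone** —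
`MissingLowerBoundAt W p` (the Eisenstein half) + the kernel upper half ⇒ Miller's `BSD(E,p)`; the
twin of `Typed.X6.bsdp_of_missingLowerBoundAt_of_analyticRank_eq_zero` (Wuthrich road) and of
`Supersingular.X6.bsdp_of_missingLowerBoundAt_of_prop48` (Perrin-Riou road) with those printed
upper-bound facts replaced by Kobayashi Thm. 4.1 / 1.2 + Kim Cor. 3.15 + period units.
[cite: Kobayashi2003, Thm. 4.1 (p. 8)] [cite: BDKim2013, Cor. 3.15 (p. 199)] [cite: Miller2011LMS, §1 and Def. 1.1] -/
theorem X6.bsdp_of_missingLowerBoundAt_of_thm41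
    (h41 : Kobayashi2003.thm41_signedCharIdeal_divisibility)
    (h12 : Kobayashi2003.thm12_signedSelmerDual_finite_torsion)
    (hKim : BDKim2013.cor315_signedCharValue_rankZero)
    (h5 : realPeriodRat_eq_unit_mul_plusPeriod) (h3 : realPeriodRat_eq_unit_mul_plusPeriod_three)
    (hmod : nonempty_modularParametrizationData) (hmod' : hasEntireLFunction_rat)
    (hGZK : rank_eq_analyticRank_of_analyticRank_le_one)
    (hp : p ≠ 2) (hX : ClassX6 W p) (h0 : W.analyticRank = 0) (hlow : MissingLowerBoundAt W p) :
    BSDp W p :=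
  bsdp_of_missingPPartAt W p hGZK (by omega)
    (missingPPartAt_of_lower_of_upper W p hlow
      (X6.missingUpperBoundAt_rankZero_of_thm41 W p h41 h12 hKim h5 h3 hmod hmod' hGZK hp hX h0))

/-- **The UNIT-VALUE sub-leaf of A6 on the Kobayashi–Kato road.** On `ClassX6 W p ∧ r_an = 0` at an
odd prime, `ord_p #Ш_an ≤ 0` gives Miller's `BSD(E,p)`: upper half from §1 (Kobayashi Thm. 4.1 /
1.2 + Kim Cor. 3.15 + period units + modularity + GZK, by name), lower half TRIVIAL
(`ord_p #Ш_an ≤ 0 ≤ ord_p #Ш`). No main-conjecture equality, no `*_OPEN` binder, no CM hypothesis.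
[cite: Kobayashi2003, Thm. 4.1 (p. 8) and Thm. 1.2 (p. 2)] [cite: BDKim2013, Cor. 3.15 (p. 199)]
[cite: GreenbergVatsal2000, §3, Remark 3.4] [cite: Miller2011LMS, §1 and Def. 1.1] -/
theorem X6.bsdp_rankZero_of_shaAn_le_of_thm41
    (h41 : Kobayashi2003.thm41_signedCharIdeal_divisibility)
    (h12 : Kobayashi2003.thm12_signedSelmerDual_finite_torsion)
    (hKim : BDKim2013.cor315_signedCharValue_rankZero)
    (h5 : realPeriodRat_eq_unit_mul_plusPeriod) (h3 : realPeriodRat_eq_unit_mul_plusPeriod_three)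
    (hmod : nonempty_modularParametrizationData) (hmod' : hasEntireLFunction_rat)
    (hGZK : rank_eq_analyticRank_of_analyticRank_le_one)
    (hp : p ≠ 2) (hX : ClassX6 W p) (h0 : W.analyticRank = 0)
    (hsha : ∃ q : ℚ, shaAn W = (q : ℂ) ∧ padicValRat p q ≤ 0) : BSDp W p := by
  obtain ⟨q, hq, hle⟩ := hsha
  exact X6.bsdp_of_missingLowerBoundAt_of_thm41 W p h41 h12 hKim h5 h3 hmod hmod' hGZK hp hX h0
    ⟨q, hq, hle.trans (by exact_mod_cast Nat.zero_le _)⟩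

/-- **Sharp form on the unit-value sub-leaf (Kobayashi–Kato road): `Ш(E/ℚ)[p^∞] = 0` and `#Ш_an` is
an exact `p`-adic unit** — `0 ≤ ord_p #Ш ≤ ord_p #Ш_an ≤ 0`.
[cite: Kobayashi2003, Thm. 4.1 (p. 8)] [cite: BDKim2013, Cor. 3.15 (p. 199)] [cite: Miller2011LMS, Def. 1.1] -/
theorem X6.padicValNat_shaOrder_eq_zero_of_shaAn_le_of_thm41
    (h41 : Kobayashi2003.thm41_signedCharIdeal_divisibility)
    (h12 : Kobayashi2003.thm12_signedSelmerDual_finite_torsion)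
    (hKim : BDKim2013.cor315_signedCharValue_rankZero)
    (h5 : realPeriodRat_eq_unit_mul_plusPeriod) (h3 : realPeriodRat_eq_unit_mul_plusPeriod_three)
    (hmod : nonempty_modularParametrizationData) (hmod' : hasEntireLFunction_rat)
    (hGZK : rank_eq_analyticRank_of_analyticRank_le_one)
    (hp : p ≠ 2) (hX : ClassX6 W p) (h0 : W.analyticRank = 0)
    (hsha : ∃ q : ℚ, shaAn W = (q : ℂ) ∧ padicValRat p q ≤ 0) :
    padicValNat p W.shaOrder = 0 ∧ ∃ q : ℚ, shaAn W = (q : ℂ) ∧ padicValRat p q = 0 := by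
  obtain ⟨q, hq, hle⟩ :=
    X6.missingUpperBoundAt_rankZero_of_thm41 W p h41 h12 hKim h5 h3 hmod hmod' hGZK hp hX h0
  obtain ⟨q', hq', hle'⟩ := hsha
  have hqq : q' = q := by exact_mod_cast hq'.symm.trans hq
  subst hqq
  have hsha0 : padicValNat p W.shaOrder = 0 := by
    have : (padicValNat p W.shaOrder : ℤ) ≤ 0 := hle.trans hle'
    omega
  refine ⟨hsha0, q', hq', le_antisymm hle' ?_⟩
  rw [hsha0, Nat.cast_zero] at hle
  exact hle

/-- **The `L`-value unit zone on the Kobayashi–Kato road**: on `ClassX6 ∧ r_an = 0`, `p` odd, with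
`L(E,1)/Ω_E = t` and `ord_p t ≤ ord_p ∏_ℓ c_ℓ` (equivalently `ord_p #Ш_an ≤ 0`, torsion being prime
to `p`), Miller's `BSD(E,p)`. [cite: Kobayashi2003, Thm. 4.1 (p. 8)] [cite: BDKim2013, Cor. 3.15 (p. 199)]
[cite: Serre1972, §1.11 Prop. 12] [cite: Miller2011LMS, Def. 1.1] -/
theorem X6.bsdp_rankZero_of_lRatio_le_tamagawa_of_thm41
    (h41 : Kobayashi2003.thm41_signedCharIdeal_divisibility)
    (h12 : Kobayashi2003.thm12_signedSelmerDual_finite_torsion)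
    (hKim : BDKim2013.cor315_signedCharValue_rankZero)
    (h5 : realPeriodRat_eq_unit_mul_plusPeriod) (h3 : realPeriodRat_eq_unit_mul_plusPeriod_three)
    (hmod : nonempty_modularParametrizationData) (hmod' : hasEntireLFunction_rat)
    (hGZK : rank_eq_analyticRank_of_analyticRank_le_one)
    (hp : p ≠ 2) (hX : ClassX6 W p) (h0 : W.analyticRank = 0) {t : ℚ}
    (ht : W.entireLFunction 1 / (W.realPeriodRat : ℂ) = (t : ℂ))
    (hv : padicValRat p t ≤ padicValNat p W.tamagawaProduct) : BSDp W p := by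
  have hL : W.entireLFunction 1 ≠ 0 := (W.analyticRank_eq_zero_iff_holds (hmod' W)).1 h0
  have ht0 : t ≠ 0 := by
    rintro rfl
    apply hL
    have hΩ : (W.realPeriodRat : ℂ) ≠ 0 := by exact_mod_cast W.realPeriodRat_pos_holds.ne'
    have h1 := ht
    rw [Rat.cast_zero, div_eq_zero_iff] at h1
    exact h1.resolve_right hΩ
  refine X6.bsdp_rankZero_of_shaAn_le_of_thm41 W p h41 h12 hKim h5 h3 hmod hmod' hGZK hp hX h0
    ⟨_, shaAn_eq_of_analyticRank_eq_zero W hGZK h0 ht, ?_⟩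
  rw [padicValRat_shaAn_witness W p (ClassX6.irr W p hp hX) ht0]
  linarith

end Summit.BirchSwinnertonDyer.BirchSwinnertonDyer.Theorems

end
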